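import Literature.MathematicalPhysics.QuantumLattice.OverlapLocalityProofs
import Summits.QuantumFields.QCD.Theorems.SpectralDefectExtinctionWindowExtinctionPeriodicIndexCarrierOf
import HarnessLib

/-!
# The Hernández–Jansen–Lüscher fact for `SU(3)` and what its discharge in `Literature/` makes
# unconditional on line `free-volume-heavy-witness` (support of stub F1′ `stub_hjlGap`)

Support file for stub F1′ `stub_hjlGap` of line `free-volume-heavy-witness` (reshape r6, lead c4) of
crux `Summit.QuantumFields.QCD.Theses.SpectralDefectExtinction.WindowExtinction`
(item stmt-QuantumFields-8964).  The stub is the skeleton's `HJLGapSU3`, unfolded —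

  for every periodic lattice `(ℤ/L)⁴` (`L ≥ 1`), every `SU(3)` gauge field `U` that is
  `ε`-norm-admissible in the fundamental representation (`‖1 − U(p)‖ ≤ ε` for all plaquettes `p`,
  `IsNormAdmissible`), and every quark field `ψ`,
  `(1 − 30ε) Σ_i ‖ψ_i‖² ≤ Σ_i ‖(D_W(U,−1,1) ψ)_i‖²`,

i.e. `D_W(−1)ᴴ D_W(−1) ≥ 1 − 30ε` (Hernández–Jansen–Lüscher 1999, Nucl. Phys. B 552, (2.16) and
App. C), conjunct (1) of the tree's named fact `HJLLocality (fundamentalRep (Fin 3))`.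

State of the tree when this file was written (2026-08-16, 22:45Z).  That exact `SU(3)` statement is
ALREADY LANDED, verbatim, as the stub of the same name of the sibling crux `TipPricing`:
`Summit.QuantumFields.QCD.Cruxes.TipPricing.HermitianFlowCoarea.stub_hjlGap`
(`Theorems/SpectralDefectExtinctionTipPricingStubHjlGap.lean`) — the gate refuses a second copy
(`dedup.landed`), so the skeleton takes F1′ from there (or from `hjl_gap` below) by name.  Moreover the
WHOLE named fact is now a theorem of `Literature/`:
`Literature.MathematicalPhysics.QuantumLattice.HJLLocality_holds` (`OverlapLocalityProofs.lean`, with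
`hjl_gap` = conjunct (1) for every unitary `ρ` and `hjl_legendre_locality` = conjunct (2)); the gap is
the case `m = −1` of Neuberger's twin bound `D_W(m)ᴴ D_W(m) ≥ m² − 30δ`
(`wilsonDirac_normSq_mulVec_ge_of_plaquette`, `WilsonDiracLowerBound.lean`, assembled from the
plaquette bounds on the commutators of the twisted shifts exactly as in HJL App. C: `10δ` per ordered
pair `μ ≠ ν`, twelve pairs, a factor `¼`; the plaquette hypothesis in both orientations comes from
admissibility for unitary `ρ`, `norm_one_sub_rep_plaquetteHolonomy_le`).  Accordingly this file only
INSTANTIATES, under names in this line's namespace, what the discharge makes unconditional here: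

* `hjlLocality_fundamentalRep : HJLLocality (fundamentalRep (Fin 3))` — the r5 named-fact stub
  `stub_HJLLocality` of this line, now a theorem; its first component is F1′
  (`hjlLocality_fundamentalRep.1 fundamentalRep_mem_unitaryGroup U ε hU ψ : HJLGapSU3`-shaped);
* `flux_transport` — the landed index transport `flux_transport_of_HJL`
  (`…FluxTransportHJL.lean`) with its `HJLLocality` premise discharged: for an `ε`-norm-admissible
  `SU(3)` field with `30ε < lo²`, `0 < lo`, and every `δ ∈ [lo, 1]`, `det (Γ₅ D_W(U,−δ,1)) ≠ 0` and the
  negative count of `Γ₅ D_W(U,−δ,1)` equals that of `Γ₅ D_W(U,−1,1)`;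
* `periodicIndexCarrier_of_IOS` — lead c3's r5 closure of S11 `stub_periodicIndexCarrier_of`
  (`…PeriodicIndexCarrierOf.lean`, conditional on `HJLLocality (fundamentalRep (Fin 3))` AND
  `IOSFluxSectorIndex`) with the first premise discharged: S11 now rests on the single named fact
  `IOSFluxSectorIndex` (Igarashi–Okuyama–Suzuki 2002, Thm 3.1).

References: P. Hernández, K. Jansen, M. Lüscher, *Locality properties of Neuberger's lattice Dirac
operator*, Nucl. Phys. B 552 (1999) 363–378, arXiv:hep-lat/9808010, (2.12), (2.15)–(2.16), App. C;
H. Neuberger, *Bounds on the Wilson Dirac operator*, Phys. Rev. D 61 (2000) 085015,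
arXiv:hep-lat/9911004, §"Lower bound".
-/

noncomputable section

namespace Summit.QuantumFields.QCD.Cruxes.WindowExtinction.FreeVolumeHeavyWitness

open Matrix
open Literature.MathematicalPhysics.QuantumLattice Literature.MathematicalPhysics.QuantumFieldTheory
  Literature.Probability.LatticeModels
open Summit.QuantumFields.QCD.Theorems.ExtinctionBuildsQCD.Negative
open scoped BigOperators

/-- **The named fact `HJLLocality` at the `SU(3)` fundamental representation** (HJL 1999, (2.16) and
(2.12): the gap AND the Legendre locality of `(A†A)^{-1/2}` on every periodic lattice) — the r5
named-fact stub `stub_HJLLocality` of this line, now the instance `ρ = fundamentalRep (Fin 3)` of the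
tree's `HJLLocality_holds`.  Its first component is stub F1′ (`HJLGapSU3`):
`fun U ε hU ψ => hjlLocality_fundamentalRep.1 fundamentalRep_mem_unitaryGroup U ε hU ψ`, landed
verbatim as `Summit.QuantumFields.QCD.Cruxes.TipPricing.HermitianFlowCoarea.stub_hjlGap`. -/
theorem hjlLocality_fundamentalRep : HJLLocality (fundamentalRep (Fin 3)) :=
  HJLLocality_holds (fundamentalRep (Fin 3))

/-- **Index transport under admissibility, unconditional.**  For an `ε`-norm-admissible `SU(3)` field
on a periodic lattice, `0 < lo`, `30ε < lo²` and every `δ ∈ [lo, 1]`: `det (Γ₅ D_W(U,−δ,1)) ≠ 0` and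
the negative characteristic-root count of `Γ₅ D_W(U,−δ,1)` equals that of `Γ₅ D_W(U,−1,1)` — the
landed `flux_transport_of_HJL` (kernel vectors of `D_W(U,−δ,1)` would violate the gap; levels of
`Γ₅ D_W(U,m,1)` cross zero only at real modes) with its `HJLLocality` premise discharged by
`hjlLocality_fundamentalRep`. -/
theorem flux_transport :
    ∀ (L : ℕ) [NeZero L] (U : GaugeConfig 4 L SU3) (ε lo : ℝ),
      IsNormAdmissible (fundamentalRep (Fin 3)) U ε → 0 < lo → 30 * ε < lo ^ 2 →
      ∀ δ : ℝ, lo ≤ δ → δ ≤ 1 →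
        (spinorLift gammaFive * wilsonDirac (fundamentalRep (Fin 3)) U (-δ) 1).det ≠ 0 ∧
        (spinorLift gammaFive * wilsonDirac (fundamentalRep (Fin 3)) U (-δ) 1).charpoly.roots.countP
            (fun z : ℂ => z.re < 0) =
          (spinorLift gammaFive * wilsonDirac (fundamentalRep (Fin 3)) U (-1) 1).charpoly.roots.countP
            (fun z : ℂ => z.re < 0) :=
  fun L _ U ε lo => flux_transport_of_HJL L U ε lo hjlLocality_fundamentalRep

/-- **S11 modulo the single named fact `IOSFluxSectorIndex`.**  For every window
`0 < lo ≤ hi ≤ Q·lo`, `hi ≤ 1/4` there are an odd torus side `2R+1` and an `SU(3)` gauge field `U₀` on it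
with `n₋(Γ₅ D_W(U₀, −δ, 1)) ≥ 6(2R+1)⁴ + 96(2R+1)³ + 1 + 12((2R+1)⁴ − (2R−1)⁴)` for all `δ ∈ [lo, hi]`,
PROVIDED the Igarashi–Okuyama–Suzuki flux-sector index formula `IOSFluxSectorIndex` holds — lead c3's
landed `flux_periodicIndexCarrier_of` (colour-diagonal embedding of Lüscher's flux-sector field,
count at `m₀ = 1`, transport by the HJL gap) with its `HJLLocality` premise discharged. -/
theorem periodicIndexCarrier_of_IOS (hIOS : IOSFluxSectorIndex) :
    ∀ (Q : ℕ) (lo hi : ℝ), 0 < lo → lo ≤ hi → hi ≤ Q * lo → hi ≤ 1 / 4 →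
      ∃ (R : ℕ) (U₀ : GaugeConfig 4 (2 * R + 1) SU3), ∀ δ : ℝ, lo ≤ δ → δ ≤ hi →
        6 * (2 * R + 1) ^ 4 + 96 * (2 * R + 1) ^ 3 + 1 + 12 * ((2 * R + 1) ^ 4 - (2 * R - 1) ^ 4) ≤
          negRootCount (spinorLift gammaFive * wilsonDirac (fundamentalRep (Fin 3)) U₀ (-δ) 1) :=
  flux_periodicIndexCarrier_of hjlLocality_fundamentalRep hIOS

end Summit.QuantumFields.QCD.Cruxes.WindowExtinction.FreeVolumeHeavyWitness

end
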